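import Summits.Parity.GeneralizedHardyLittlewood.Theorems.LiouvilleShiftedTablesEngineToPairsDefs
import Literature.NumberTheory.Sieve.BombieriFriedlanderIwaniecDecomposition
import Literature.NumberTheory.Sieve.BombieriAsymptoticSieveLemma12

/-!
# Correlation sieve for line `Sketch` of the crux `EngineToPairs` (stmt-Parity-14659), part 2:
# double-sum expansion of the functional and the generic Type-II / Type-I dispatch

Support file for the stub `stub_sieve : CorrelationSieveFamily`.  For a weight family `w q` and the
functional `∑_{x/2 < n ≤ x} F(n) w_q(n)` (= `Sieve.corrFun (w q) x F` of part 1, written out here):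

* `sum_Ioc_mul_apply_mul_weight` — at a Dirichlet product `F = α ⋆ β` the functional is the double sum
  `∑_{m ≤ x} ∑_{n ≤ x, x/2 < mn ≤ x} α(m) β(n) w(mn)`;
* `typeII_dispatch` — if `α` is supported in the Type-II window and `|α| ≤ L_a τ^B`, `|β| ≤ L_b τ^B`, the
  family sum of the functional at `α ⋆ β` is at most `L_a L_b · TII` under `TypeIIFam … TII`;
* `typeI_dispatch_one`, `typeI_dispatch_log` — if `α` is supported on `m ≤ x^γ` with `|α| ≤ L_a τ^B` and
  `β` is the indicator of an integer interval (times `log`), the family sum is at most `L_a · TI`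
  (resp. `2 L_a log x · TI`) under `TypeIFam … TI` (the `log` by discrete Abel summation, one interval per
  `(q, m)` chosen at the maximum of the partial sums).
-/

noncomputable section

namespace Summit.Parity.GeneralizedHardyLittlewood.Theorems.EngineToPairs.Sieve

open Finset Real
open Literature.NumberTheory.Sieve

/-! ### The functional at a Dirichlet product -/

/-- For naturals `k` and `x ≥ 0`: `k ≤ ⌊x⌋₊ ↔ (k : ℝ) ≤ x`. [folklore] -/
theorem natLe_floor_iff {k : ℕ} {x : ℝ} (hx : 0 ≤ x) : k ≤ ⌊x⌋₊ ↔ (k : ℝ) ≤ x := by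
  rcases Nat.eq_zero_or_pos k with rfl | hk
  · simp [hx]
  · exact Nat.le_floor_iff hx

/-- **The functional at a product is a double sum**: for `x ≥ 0`,
`∑_{x/2 < n ≤ x} (α ⋆ β)(n) w(n) = ∑_{m ≤ x} ∑_{n ≤ x, x/2 < mn ≤ x} α(m) β(n) w(mn)`. [folklore] -/
theorem sum_Ioc_mul_apply_mul_weight (α β : ArithmeticFunction ℝ) (w : ℕ → ℝ) {x : ℝ} (hx : 0 ≤ x) :
    ∑ n ∈ Ioc ⌊x / 2⌋₊ ⌊x⌋₊, (α * β) n * w n =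
      ∑ m ∈ Icc 1 ⌊x⌋₊, ∑ n ∈ (Icc 1 ⌊x⌋₊).filter
        (fun n : ℕ => x / 2 < (m : ℝ) * n ∧ (m : ℝ) * n ≤ x), α m * β n * w (m * n) := by
  classical
  set N := ⌊x⌋₊ with hN
  set hh : ℕ → ℝ := fun n => if ⌊x / 2⌋₊ < n then w n else 0 with hhh
  have hx2 : 0 ≤ x / 2 := by positivity
  -- Step 1: extend the range to `Ioc 0 N` with the weight `hh`
  have h1 : ∑ n ∈ Ioc ⌊x / 2⌋₊ N, (α * β) n * w n = ∑ n ∈ Ioc 0 N, (α * β) n * hh n := by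
    have hsub : Ioc ⌊x / 2⌋₊ N ⊆ Ioc 0 N := Ioc_subset_Ioc_left (Nat.zero_le _)
    rw [← Finset.sum_subset hsub]
    · refine Finset.sum_congr rfl fun n hn => ?_
      rw [hhh]; simp only [(mem_Ioc.1 hn).1, if_true]
    · intro n hn hn'
      have : ¬ ⌊x / 2⌋₊ < n := fun h => hn' (mem_Ioc.2 ⟨h, (mem_Ioc.1 hn).2⟩)
      simp [hhh, this]
  rw [h1, BFI.sum_Ioc_mul_apply_mul]
  -- Step 2: rewrite the filtered product set as the iterated filtered sum
  have h2 : ∀ p ∈ (Ioc 0 N ×ˢ Ioc 0 N).filter (fun p : ℕ × ℕ => p.1 * p.2 ≤ N),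
      α p.1 * β p.2 * hh (p.1 * p.2) =
        if x / 2 < (p.1 : ℝ) * p.2 ∧ (p.1 : ℝ) * p.2 ≤ x then α p.1 * β p.2 * w (p.1 * p.2) else 0 := by
    intro p hp
    obtain ⟨-, hpN⟩ := Finset.mem_filter.1 hp
    have hle : ((p.1 * p.2 : ℕ) : ℝ) ≤ x := (natLe_floor_iff hx).1 hpN
    push_cast at hle
    by_cases hlt : ⌊x / 2⌋₊ < p.1 * p.2
    · have hlt' : x / 2 < (p.1 : ℝ) * p.2 := by
        have := (Nat.floor_lt hx2).1 hlt; push_cast at this; exact this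
      simp [hhh, hlt, hlt', hle]
    · have hlt' : ¬ (x / 2 < (p.1 : ℝ) * p.2) := by
        intro h; apply hlt; rw [Nat.floor_lt hx2]; push_cast; exact h
      simp [hhh, hlt, hlt']
  rw [Finset.sum_congr rfl h2, Finset.sum_filter, Finset.sum_product]
  have hIoc : Ioc 0 N = Icc 1 N := rfl
  rw [hIoc]
  refine Finset.sum_congr rfl fun m hm => ?_
  rw [Finset.sum_filter]
  refine Finset.sum_congr rfl fun n hn => ?_
  by_cases hc : x / 2 < (m : ℝ) * n ∧ (m : ℝ) * n ≤ x
  · have hmn : m * n ≤ N := by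
      rw [hN, natLe_floor_iff hx]; push_cast; exact hc.2
    simp [hc, hmn]
  · by_cases hmn : m * n ≤ N <;> simp [hc, hmn]

/-! ### Generic Type-II dispatch -/

/-- **Type-II dispatch.**  If `α` is supported in the window `((x/2)^θ, x^{θ+ν}]` (`θ + ν ≤ 1 ≤ x`) with
`|α| ≤ L_a τ^B` and `|β| ≤ L_b τ^B`, then under `TypeIIFam Qs w x θ ν B TII`:
`∑_{q ∈ Qs} |∑_{x/2<n≤x} (α ⋆ β)(n) w_q(n)| ≤ L_a L_b TII`. [this line] -/
theorem typeII_dispatch {Qs : Finset ℕ} {w : ℕ → ℕ → ℝ} {x θ ν : ℝ} {B : ℕ} {TII : ℝ}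
    (hfam : TypeIIFam Qs w x θ ν B TII) (hx : 1 ≤ x) (hθν : θ + ν ≤ 1)
    (α β : ArithmeticFunction ℝ) {La Lb : ℝ} (hLa : 0 < La) (hLb : 0 < Lb)
    (hαsupp : ∀ m, α m ≠ 0 → (x / 2) ^ θ < (m : ℝ) ∧ (m : ℝ) ≤ x ^ (θ + ν))
    (hα : ∀ m, |α m| ≤ La * tauPow B m) (hβ : ∀ n, |β n| ≤ Lb * tauPow B n) :
    ∑ q ∈ Qs, |∑ n ∈ Ioc ⌊x / 2⌋₊ ⌊x⌋₊, (α * β) n * w q n| ≤ La * Lb * TII := by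
  classical
  have hx0 : 0 ≤ x := by linarith
  set W := (Icc 1 ⌊x ^ (θ + ν)⌋₊).filter (fun m : ℕ => (x / 2) ^ θ < (m : ℝ)) with hW
  set ξ : ℕ → ℝ := fun m => α m / La with hξ
  set κ : ℕ → ℝ := fun n => β n / Lb with hκ
  have hξb : ∀ m, |ξ m| ≤ tauPow B m := fun m => by
    rw [hξ, abs_div, abs_of_pos hLa, div_le_iff₀ hLa, mul_comm]; exact hα m
  have hκb : ∀ n, |κ n| ≤ tauPow B n := fun n => by
    rw [hκ, abs_div, abs_of_pos hLb, div_le_iff₀ hLb, mul_comm]; exact hβ n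
  have hmain := hfam ξ κ hξb hκb
  -- identify each functional with `La * Lb *` the Type-II expression
  have hq : ∀ q, ∑ n ∈ Ioc ⌊x / 2⌋₊ ⌊x⌋₊, (α * β) n * w q n =
      La * Lb * ∑ m ∈ W, ∑ n ∈ (Icc 1 ⌊x⌋₊).filter
        (fun n : ℕ => x / 2 < (m : ℝ) * n ∧ (m : ℝ) * n ≤ x), ξ m * κ n * w q (m * n) := by
    intro q
    rw [sum_Ioc_mul_apply_mul_weight α β (w q) hx0]
    have hWsub : W ⊆ Icc 1 ⌊x⌋₊ := by
      intro m hm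
      rw [hW, Finset.mem_filter, Finset.mem_Icc] at hm
      refine Finset.mem_Icc.2 ⟨hm.1.1, hm.1.2.trans (Nat.floor_mono ?_)⟩
      calc x ^ (θ + ν) ≤ x ^ (1 : ℝ) := Real.rpow_le_rpow_of_exponent_le hx hθν
        _ = x := Real.rpow_one x
    rw [← Finset.sum_subset hWsub]
    · rw [Finset.mul_sum]
      refine Finset.sum_congr rfl fun m _ => ?_
      rw [Finset.mul_sum]
      refine Finset.sum_congr rfl fun n _ => ?_
      rw [hξ, hκ]
      field_simp
    · intro m hm hmW
      have hα0 : α m = 0 := by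
        by_contra h
        obtain ⟨h1, h2⟩ := hαsupp m h
        apply hmW
        rw [hW, Finset.mem_filter, Finset.mem_Icc]
        exact ⟨⟨(Finset.mem_Icc.1 hm).1, (natLe_floor_iff (by positivity)).2 h2⟩, h1⟩
      simp [hα0]
  calc ∑ q ∈ Qs, |∑ n ∈ Ioc ⌊x / 2⌋₊ ⌊x⌋₊, (α * β) n * w q n|
      = ∑ q ∈ Qs, La * Lb * |∑ m ∈ W, ∑ n ∈ (Icc 1 ⌊x⌋₊).filter
          (fun n : ℕ => x / 2 < (m : ℝ) * n ∧ (m : ℝ) * n ≤ x), ξ m * κ n * w q (m * n)| := by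
        refine Finset.sum_congr rfl fun q _ => ?_
        rw [hq q, abs_mul, abs_of_pos (mul_pos hLa hLb)]
    _ = La * Lb * ∑ q ∈ Qs, |∑ m ∈ W, ∑ n ∈ (Icc 1 ⌊x⌋₊).filter
          (fun n : ℕ => x / 2 < (m : ℝ) * n ∧ (m : ℝ) * n ≤ x), ξ m * κ n * w q (m * n)| := by
        rw [Finset.mul_sum]
    _ ≤ La * Lb * TII := mul_le_mul_of_nonneg_left hmain (mul_pos hLa hLb).le

/-! ### Generic Type-I dispatch -/

/-- The inner Type-I sum of the double expansion only sees `m ≤ x^γ` when `α` is supported there.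
[this line] -/
theorem sum_Icc_floor_eq_sum_Icc_floor_rpow {x γ : ℝ} (hx : 1 ≤ x) (hγ : γ ≤ 1) (α : ArithmeticFunction ℝ)
    (hαsupp : ∀ m, α m ≠ 0 → (m : ℝ) ≤ x ^ γ) (G : ℕ → ℝ) :
    ∑ m ∈ Icc 1 ⌊x⌋₊, α m * G m = ∑ m ∈ Icc 1 ⌊x ^ γ⌋₊, α m * G m := by
  have hsub : Icc 1 ⌊x ^ γ⌋₊ ⊆ Icc 1 ⌊x⌋₊ := by
    refine Icc_subset_Icc_right (Nat.floor_mono ?_)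
    calc x ^ γ ≤ x ^ (1 : ℝ) := Real.rpow_le_rpow_of_exponent_le hx hγ
      _ = x := Real.rpow_one x
  rw [← Finset.sum_subset hsub]
  intro m hm hm'
  have : α m = 0 := by
    by_contra h
    apply hm'
    exact Finset.mem_Icc.2 ⟨(Finset.mem_Icc.1 hm).1,
      (natLe_floor_iff (by positivity)).2 (hαsupp m h)⟩
  simp [this]

/-- **Type-I dispatch, constant coefficient.**  `α` supported on `m ≤ x^γ` (`γ ≤ 1 ≤ x`) with
`|α| ≤ L_a τ^B`, `β = 1_{[a, b]}` with `a ≥ 1`: under `TypeIFam Qs w x γ B TI`,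
`∑_{q} |∑_{x/2<n≤x} (α ⋆ β)(n) w_q(n)| ≤ L_a TI`. [this line] -/
theorem typeI_dispatch_one {Qs : Finset ℕ} {w : ℕ → ℕ → ℝ} {x γ : ℝ} {B : ℕ} {TI : ℝ}
    (hfam : TypeIFam Qs w x γ B TI) (hx : 1 ≤ x) (hγ : γ ≤ 1)
    (α β : ArithmeticFunction ℝ) {La : ℝ} (hLa : 0 < La)
    (hαsupp : ∀ m, α m ≠ 0 → (m : ℝ) ≤ x ^ γ) (hα : ∀ m, |α m| ≤ La * tauPow B m)
    {a b : ℕ} (ha : 1 ≤ a) (hβ : ∀ n, β n = if a ≤ n ∧ n ≤ b then 1 else 0) :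
    ∑ q ∈ Qs, |∑ n ∈ Ioc ⌊x / 2⌋₊ ⌊x⌋₊, (α * β) n * w q n| ≤ La * TI := by
  classical
  have hx0 : 0 ≤ x := by linarith
  set P : ℕ → ℕ → Prop := fun m n => x / 2 < (m : ℝ) * n ∧ (m : ℝ) * n ≤ x with hP
  -- the inner sum for fixed `(q, m)` is the sum over `[a, b]` filtered by `P m`
  have hinner : ∀ q, ∀ m ∈ Icc 1 ⌊x⌋₊,
      ∑ n ∈ (Icc 1 ⌊x⌋₊).filter (fun n : ℕ => P m n), α m * β n * w q (m * n) =
        α m * ∑ n ∈ (Icc a b).filter (fun n : ℕ => P m n), w q (m * n) := by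
    intro q m hm
    have hm1 : (1 : ℝ) ≤ m := by exact_mod_cast (Finset.mem_Icc.1 hm).1
    rw [Finset.mul_sum]
    -- both sides are sums over `{n : a ≤ n ≤ b, P m n}` (which lies inside `[1, ⌊x⌋]`)
    rw [Finset.sum_filter, Finset.sum_filter]
    have hsub : Icc a b ∩ Icc 1 ⌊x⌋₊ ⊆ Icc 1 ⌊x⌋₊ := Finset.inter_subset_right
    symm
    rw [← Finset.sum_subset (Finset.inter_subset_left (s₂ := Icc 1 ⌊x⌋₊) (s₁ := Icc a b))]
    · rw [← Finset.sum_subset hsub]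
      · refine Finset.sum_congr rfl fun n hn => ?_
        have hab : a ≤ n ∧ n ≤ b := Finset.mem_Icc.1 (Finset.mem_inter.1 hn).1
        rw [hβ n, if_pos hab]; split_ifs <;> ring
      · intro n hn hn'
        have hab : ¬ (a ≤ n ∧ n ≤ b) := fun h => hn' (Finset.mem_inter.2 ⟨Finset.mem_Icc.2 h, hn⟩)
        rw [hβ n, if_neg hab]; split_ifs <;> ring
    · intro n hn hn'
      -- `n ∈ [a,b]` but `n ∉ [1, ⌊x⌋]`: then `P m n` fails
      have hnx : ¬ P m n := by
        intro hPn
        apply hn'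
        refine Finset.mem_inter.2 ⟨hn, Finset.mem_Icc.2 ⟨le_trans ha (Finset.mem_Icc.1 hn).1, ?_⟩⟩
        rw [natLe_floor_iff hx0]
        have : (n : ℝ) ≤ (m : ℝ) * n := le_mul_of_one_le_left (Nat.cast_nonneg n) hm1
        exact this.trans hPn.2
      rw [if_neg hnx]
  -- bound each functional
  have hq : ∀ q ∈ Qs, |∑ n ∈ Ioc ⌊x / 2⌋₊ ⌊x⌋₊, (α * β) n * w q n| ≤
      La * ∑ m ∈ Icc 1 ⌊x ^ γ⌋₊, tauPow B m *
        |∑ n ∈ (Icc a b).filter (fun n : ℕ => P m n), w q (m * n)| := by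
    intro q _
    rw [sum_Ioc_mul_apply_mul_weight α β (w q) hx0, Finset.sum_congr rfl (hinner q),
      sum_Icc_floor_eq_sum_Icc_floor_rpow hx hγ α hαsupp, Finset.mul_sum]
    refine (Finset.abs_sum_le_sum_abs _ _).trans (Finset.sum_le_sum fun m _ => ?_)
    rw [abs_mul, ← mul_assoc]
    exact mul_le_mul_of_nonneg_right (hα m) (abs_nonneg _)
  refine (Finset.sum_le_sum hq).trans ?_
  rw [← Finset.mul_sum]
  refine mul_le_mul_of_nonneg_left ?_ hLa.le
  exact hfam (fun _ _ => (a, b))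

/-- `Real.log` on the naturals is monotone. [folklore] -/
theorem monotone_log_natCast : Monotone (fun n : ℕ => Real.log (n : ℝ)) := by
  intro m n hmn
  rcases Nat.eq_zero_or_pos m with rfl | hm
  · simp only [Nat.cast_zero, Real.log_zero]
    exact Real.log_natCast_nonneg n
  · exact Real.log_le_log (by exact_mod_cast hm) (by exact_mod_cast hmn)

/-- **Type-I dispatch, logarithmic coefficient.**  As `typeI_dispatch_one` but with `β = log · 1_{[a, b]}`:
`∑_{q} |∑_{x/2<n≤x} (α ⋆ β)(n) w_q(n)| ≤ 2 L_a log x · TI` (discrete Abel summation; for each `(q, m)`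
the interval of `TypeIFam` is `[a, t]` with `t` maximising the partial sum). [this line] -/
theorem typeI_dispatch_log {Qs : Finset ℕ} {w : ℕ → ℕ → ℝ} {x γ : ℝ} {B : ℕ} {TI : ℝ}
    (hfam : TypeIFam Qs w x γ B TI) (hx : 1 ≤ x) (hγ : γ ≤ 1)
    (α β : ArithmeticFunction ℝ) {La : ℝ} (hLa : 0 < La)
    (hαsupp : ∀ m, α m ≠ 0 → (m : ℝ) ≤ x ^ γ) (hα : ∀ m, |α m| ≤ La * tauPow B m)
    {a b : ℕ} (ha : 1 ≤ a) (hbx : (b : ℝ) ≤ x)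
    (hβ : ∀ n, β n = if a ≤ n ∧ n ≤ b then Real.log n else 0) :
    ∑ q ∈ Qs, |∑ n ∈ Ioc ⌊x / 2⌋₊ ⌊x⌋₊, (α * β) n * w q n| ≤ 2 * La * Real.log x * TI := by
  classical
  have hx0 : 0 ≤ x := by linarith
  have hlogx : 0 ≤ Real.log x := Real.log_nonneg hx
  set P : ℕ → ℕ → Prop := fun m n => x / 2 < (m : ℝ) * n ∧ (m : ℝ) * n ≤ x with hP
  -- partial sums of the filtered interval sums and their maximiser
  set S : ℕ → ℕ → ℕ → ℝ := fun q m t => ∑ n ∈ (Icc a t).filter (fun n : ℕ => P m n), w q (m * n) with hS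
  have hmax : ∀ q m, ∃ t ∈ Finset.range (b + 1), ∀ t' ∈ Finset.range (b + 1), |S q m t'| ≤ |S q m t| :=
    fun q m => Finset.exists_max_image (Finset.range (b + 1)) (fun t => |S q m t|) ⟨0, by simp⟩
  choose tmax htmax_mem htmax using hmax
  -- the inner sum for fixed `(q, m)`, as an Abel-ready sum over `Ioc 0 b`
  have hinner : ∀ q, ∀ m ∈ Icc 1 ⌊x⌋₊,
      ∑ n ∈ (Icc 1 ⌊x⌋₊).filter (fun n : ℕ => P m n), α m * β n * w q (m * n) =
        α m * ∑ n ∈ Ioc 0 b, (if a ≤ n ∧ P m n then w q (m * n) else 0) * Real.log n := by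
    intro q m hm
    have hm1 : (1 : ℝ) ≤ m := by exact_mod_cast (Finset.mem_Icc.1 hm).1
    rw [Finset.mul_sum, Finset.sum_filter]
    -- compare both as sums over ℕ of a function supported on `{a ≤ n ≤ b, P m n}`
    have key : ∀ n, (if P m n then α m * β n * w q (m * n) else 0) =
        α m * ((if a ≤ n ∧ P m n then w q (m * n) else 0) * Real.log n) * (if n ≤ b then 1 else 0) := by
      intro n
      rw [hβ n]
      by_cases h1 : P m n <;> by_cases h2 : a ≤ n <;> by_cases h3 : n ≤ b <;> (simp [h1, h2, h3]; try ring)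
    rw [Finset.sum_congr rfl (fun n _ => key n)]
    have hsupp : ∀ n, n ∉ Icc 1 ⌊x⌋₊ →
        α m * ((if a ≤ n ∧ P m n then w q (m * n) else 0) * Real.log n) * (if n ≤ b then 1 else 0) = 0 := by
      intro n hn
      have : ¬ (a ≤ n ∧ P m n) := by
        rintro ⟨han, hPn⟩
        apply hn
        refine Finset.mem_Icc.2 ⟨le_trans ha han, ?_⟩
        rw [natLe_floor_iff hx0]
        exact (le_mul_of_one_le_left (Nat.cast_nonneg n) hm1).trans hPn.2
      simp [this]
    have hsupp' : ∀ n, n ∉ Ioc 0 b →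
        α m * ((if a ≤ n ∧ P m n then w q (m * n) else 0) * Real.log n) * (if n ≤ b then 1 else 0) = 0 := by
      intro n hn
      by_cases hnb : n ≤ b
      · have hn0 : n = 0 := by
          by_contra h
          exact hn (Finset.mem_Ioc.2 ⟨Nat.pos_of_ne_zero h, hnb⟩)
        subst hn0
        simp
      · simp [hnb]
    rw [Finset.sum_subset_zero_on_sdiff (Finset.subset_union_left (s₂ := Ioc 0 b))
        (fun n hn => hsupp n (Finset.mem_sdiff.1 hn).2) (fun _ _ => rfl),
      ← Finset.sum_subset_zero_on_sdiff (Finset.subset_union_right (s₁ := Icc 1 ⌊x⌋₊))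
        (fun n hn => hsupp' n (Finset.mem_sdiff.1 hn).2) (fun _ _ => rfl)]
    refine Finset.sum_congr rfl fun n hn => ?_
    rw [if_pos (Finset.mem_Ioc.1 hn).2, mul_one]
  -- Abel bound for each `(q, m)`
  have habel : ∀ q, ∀ m ∈ Icc 1 ⌊x⌋₊,
      |∑ n ∈ Ioc 0 b, (if a ≤ n ∧ P m n then w q (m * n) else 0) * Real.log n| ≤
        2 * |S q m (tmax q m)| * Real.log x := by
    intro q m _
    have h1 := BombieriSieve.abs_sum_Ioc_mul_le_of_monotone
      (e := fun n => if a ≤ n ∧ P m n then w q (m * n) else 0) (φ := fun n : ℕ => Real.log (n : ℝ))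
      (N := b) (R := |S q m (tmax q m)|) ?_ monotone_log_natCast (fun n => Real.log_natCast_nonneg n)
    · refine h1.trans ?_
      have hlogb : Real.log (b : ℝ) ≤ Real.log x := by
        rcases Nat.eq_zero_or_pos b with rfl | hb
        · simp [hlogx]
        · exact Real.log_le_log (by exact_mod_cast hb) hbx
      have h0 : 0 ≤ 2 * |S q m (tmax q m)| := by positivity
      nlinarith
    · intro t ht
      have hSt : ∑ n ∈ Ioc 0 t, (if a ≤ n ∧ P m n then w q (m * n) else 0) = S q m t := by
        rw [hS]
        simp only
        rw [Finset.sum_filter]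
        -- both are sums of a function supported on `[a, t] ∩ {P}`
        have hIcc : Icc a t ⊆ Ioc 0 t := fun n hn =>
          Finset.mem_Ioc.2 ⟨lt_of_lt_of_le (by omega) (Finset.mem_Icc.1 hn).1, (Finset.mem_Icc.1 hn).2⟩
        rw [← Finset.sum_subset hIcc]
        · refine Finset.sum_congr rfl fun n hn => ?_
          have han : a ≤ n := (Finset.mem_Icc.1 hn).1
          by_cases hPn : P m n <;> simp [han, hPn]
        · intro n hn hn'
          have : ¬ (a ≤ n ∧ P m n) := fun h => hn' (Finset.mem_Icc.2 ⟨h.1, (Finset.mem_Ioc.1 hn).2⟩)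
          simp [this]
      rw [hSt]
      exact htmax q m t (Finset.mem_range.2 (Nat.lt_succ_of_le ht))
  -- assemble
  have hq : ∀ q ∈ Qs, |∑ n ∈ Ioc ⌊x / 2⌋₊ ⌊x⌋₊, (α * β) n * w q n| ≤
      2 * La * Real.log x * ∑ m ∈ Icc 1 ⌊x ^ γ⌋₊, tauPow B m * |S q m (tmax q m)| := by
    intro q _
    rw [sum_Ioc_mul_apply_mul_weight α β (w q) hx0, Finset.sum_congr rfl (hinner q)]
    have hsupp2 : ∀ m, α m ≠ 0 → (m : ℝ) ≤ x ^ γ := hαsupp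
    rw [sum_Icc_floor_eq_sum_Icc_floor_rpow hx hγ α hsupp2, Finset.mul_sum]
    refine (Finset.abs_sum_le_sum_abs _ _).trans (Finset.sum_le_sum fun m hm => ?_)
    have hmx : m ∈ Icc 1 ⌊x⌋₊ := by
      refine Finset.mem_Icc.2 ⟨(Finset.mem_Icc.1 hm).1, (Finset.mem_Icc.1 hm).2.trans (Nat.floor_mono ?_)⟩
      calc x ^ γ ≤ x ^ (1 : ℝ) := Real.rpow_le_rpow_of_exponent_le hx hγ
        _ = x := Real.rpow_one x
    rw [abs_mul]
    calc |α m| * |∑ n ∈ Ioc 0 b, (if a ≤ n ∧ P m n then w q (m * n) else 0) * Real.log n|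
        ≤ (La * tauPow B m) * (2 * |S q m (tmax q m)| * Real.log x) :=
          mul_le_mul (hα m) (habel q m hmx) (abs_nonneg _) (by have := tauPow_nonneg B m; positivity)
      _ = 2 * La * Real.log x * (tauPow B m * |S q m (tmax q m)|) := by ring
  refine (Finset.sum_le_sum hq).trans ?_
  rw [← Finset.mul_sum]
  refine mul_le_mul_of_nonneg_left ?_ (by positivity)
  have := hfam (fun q m => (a, tmax q m))
  exact this

end Summit.Parity.GeneralizedHardyLittlewood.Theorems.EngineToPairs.Sieve

namespace Summit.Parity.GeneralizedHardyLittlewood.Theorems.EngineToPairs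

/-- Registered sub-goal of `stub_sieve` carried by this part (landing mechanics for helper files of a
registered skeleton): `log` is monotone on `ℕ` (used by the Abel step of `Sieve.typeI_dispatch_log`). [folklore] -/
theorem sieve_part2_anchor : Monotone (fun n : ℕ => Real.log (n : ℝ)) := Sieve.monotone_log_natCast

end Summit.Parity.GeneralizedHardyLittlewood.Theorems.EngineToPairs

end
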